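import Mathlib
import HarnessLib
import Literature.Analysis.FluidPDE.SuitableWeak
import Literature.Analysis.FluidPDE.SelfSimilar
import Literature.Analysis.FluidPDE.LocalTypeI
import Literature.Analysis.FluidPDE.SpaceTimeRescaling
import Literature.Analysis.FluidPDE.LocalTypeIScaling
import Literature.Analysis.FluidPDE.LocalTypeICongr
import Literature.Analysis.FluidPDE.LocalTypeIReverseZoom
import Literature.Analysis.FluidPDE.SlabTypeICompactness
import Literature.Analysis.FluidPDE.TypeIRateOseenMildRepresentative
import Summits.NavierStokesRegularity.NavierStokesRegularity.Theorems.RellichScarApexLocalisationSpherePersistence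

/-!
# Counting lumps against the weak-`L³` slice bound
# (line russian-doll-multiplicity of crux `RellichScar.ApexLocalisation`, stub `stub_rdCount`)

Let `w : ℝ → ℝ³ → ℝ³` be continuous on the open backward slab `(-∞, 0) × ℝ³` and suppose that
for a.e. `t < 0` every slice is uniformly in weak-`L³`:
`h³ |{x : h < ‖w(t,x)‖}| ≤ M` for all `h > 0`.  If `n` unit parabolic cylinders
`Q_1(0, yᵢ) = (−1, 0) × B_1(yᵢ)` over `2`-separated centres `yᵢ` each contain measure `≥ μ`
of the space–time set `{η/√(−t) < ‖w‖}`, then `n μ η³ ≤ M` (`stub_rdCount`).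

Proof (pure measure theory, Tonelli + a Chebyshev-type count):

1. each lump set is contained in the OPEN set
   `Bᵢ = ((−1,0) × B_1(yᵢ)) ∩ {η < ‖w‖}` (on `Q_1(0,yᵢ)` one has `0 < −t < 1`, so
   `η ≤ η/√(−t)`; openness from the continuity of `w` on the slab), hence
   `μ ≤ |Bᵢ| = ∫ |Bᵢ(t)| dt` (Tonelli, `Measure.prod_apply`);
2. for `t ∈ (−1, 0)` the slices `Bᵢ(t) ⊆ B_1(yᵢ) ∩ {x : η < ‖w(t,x)‖}` are pairwise disjoint
   (the balls `B_1(yᵢ)` are, `‖yᵢ − yⱼ‖ ≥ 2`), and they are empty for other `t`; so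
   `∑ᵢ |Bᵢ(t)| ≤ 𝟙_{(−1,0)}(t) |{x : η < ‖w(t,x)‖}|`;
3. integrating, `n μ ≤ ∫_{−1}^{0} |{x : η < ‖w(t,x)‖}| dt`, and the a.e. slice bound at `h = η`
   gives `η³ n μ ≤ ∫_{−1}^{0} M dt = M`.

## References

* D. Albritton, T. Barker, *On local Type I singularities of the Navier–Stokes equations and
  Liouville theorems*, J. Math. Fluid Mech. 21 (2019), §3 (weak-`L³` slices of Type-I
  profiles). [AlbrittonBarker2019]  The counting step itself is folklore measure theory.
-/

noncomputable section

-- the summit and its single sub-problem share the name (CONVENTIONS §1), as in every Theorems file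
set_option linter.dupNamespace false

namespace Summit.NavierStokesRegularity.NavierStokesRegularity.Theorems.RellichScarApexLocalisation

open MeasureTheory Set Function Metric Filter Topology TopologicalSpace
open scoped ENNReal NNReal
open Literature.Analysis Literature.Analysis.FluidPDE

local notation "E³" => EuclideanSpace ℝ (Fin 3)

/-- The open backward slab `(-∞, 0) × ℝ³` (time first). -/
local notation "𝕊" => Literature.Analysis.FluidPDE.slab (EuclideanSpace ℝ (Fin 3)) (Set.Iio (0 : ℝ)) isOpen_Iio

/-! ### Tools -/

/-- The enlarged lump set `((−1,0) × B_1(c)) ∩ {η < ‖w‖}` of a field continuous on the open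
backward slab is open (`ContinuousOn.isOpen_inter_preimage`). [folklore] -/
theorem rdCount_isOpen_box (η : ℝ) (w : ℝ → E³ → E³) (c : E³)
    (hcont : ContinuousOn (uncurry w) (Iio (0 : ℝ) ×ˢ univ)) :
    IsOpen ((Ioo (-1 : ℝ) 0 ×ˢ ball c 1) ∩ uncurry w ⁻¹' {v : E³ | η < ‖v‖}) :=
  (hcont.mono (prod_mono Ioo_subset_Iio_self (subset_univ _))).isOpen_inter_preimage
    (isOpen_Ioo.prod isOpen_ball) (isOpen_lt continuous_const continuous_norm)

/-- On the unit cylinder `Q_1(0, c)` one has `0 < −t < 1`, hence `η ≤ η/√(−t)` for `η > 0`: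
the lump set `{z ∈ Q_1(0,c) : η/√(−t) < ‖w z‖}` lies in the enlarged set
`((−1,0) × B_1(c)) ∩ {η < ‖w‖}`. [folklore] -/
theorem rdCount_lump_subset_box {η : ℝ} (hη : 0 < η) (w : ℝ → E³ → E³) (c : E³) :
    {z ∈ parabolicCylinder 1 ((0 : ℝ), c) | η / Real.sqrt (-z.1) < ‖w z.1 z.2‖} ⊆
      (Ioo (-1 : ℝ) 0 ×ˢ ball c 1) ∩ uncurry w ⁻¹' {v : E³ | η < ‖v‖} := by
  rintro ⟨t, x⟩ ⟨hz, hlt⟩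
  rw [mem_parabolicCylinder] at hz
  obtain ⟨⟨ht1, ht0⟩, hx⟩ := hz
  dsimp only at ht1 ht0 hx hlt
  refine ⟨⟨⟨by linarith, ht0⟩, hx⟩, ?_⟩
  show η < ‖w t x‖
  refine lt_of_le_of_lt ?_ hlt
  rw [le_div_iff₀ (Real.sqrt_pos.2 (by linarith))]
  have h1 : Real.sqrt (-t) ≤ 1 := Real.sqrt_le_one.2 (by linarith)
  nlinarith

/-- Slices of the enlarged lump sets: for `t ∈ (−1, 0)` the `t`-slice of
`((−1,0) × B_1(c)) ∩ {η < ‖w‖}` lies in `B_1(c) ∩ {x : η < ‖w(t,x)‖}`, and it is empty for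
`t ∉ (−1, 0)`. [folklore] -/
theorem rdCount_slice_subset (η : ℝ) (w : ℝ → E³ → E³) (c : E³) (t : ℝ) :
    Prod.mk t ⁻¹' ((Ioo (-1 : ℝ) 0 ×ˢ ball c 1) ∩ uncurry w ⁻¹' {v : E³ | η < ‖v‖}) ⊆
      {x : E³ | t ∈ Ioo (-1 : ℝ) 0 ∧ x ∈ ball c 1 ∧ η < ‖w t x‖} := by
  intro x hx
  exact ⟨hx.1.1, hx.1.2, hx.2⟩

/-! ### The stub -/

/-- **S5 (stub_rdCount).** If a field continuous on the open slab has `h³ |{x : h < ‖w(t,x)‖}| ≤ M` for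
a.e. `t < 0` and every `h > 0`, and `n` unit cylinders `Q_1(0, yᵢ)` over `2`-separated centres each
contain measure `≥ μ` of `{η/√(−t) < ‖w‖}`, then `n μ η³ ≤ M` (Tonelli: the sets have disjoint slices
inside `{x : η < ‖w(t,x)‖}`, `t ∈ (−1, 0)`). [folklore] -/
theorem stub_rdCount :
    ∀ (M η μ : ℝ) (n : ℕ) (w : ℝ → E³ → E³) (y : Fin n → E³),
      0 < η → 0 < μ → ContinuousOn (uncurry w) (Iio (0 : ℝ) ×ˢ univ) →
      (∀ᵐ t : ℝ, t < 0 → ∀ h : ℝ, 0 < h →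
        ENNReal.ofReal (h ^ 3) * volume {x : E³ | h < ‖w t x‖} ≤ ENNReal.ofReal M) →
      (∀ i j, i ≠ j → 2 ≤ ‖y i - y j‖) →
      (∀ i, ENNReal.ofReal μ ≤
        volume {z ∈ parabolicCylinder 1 ((0 : ℝ), y i) | η / Real.sqrt (-z.1) < ‖w z.1 z.2‖}) →
      ENNReal.ofReal ((n : ℝ) * μ * η ^ 3) ≤ ENNReal.ofReal M := by
  intro M η μ n w y hη hμ hcont hM hsep hlump
  -- the enlarged (open, hence measurable) lump sets
  set B : Fin n → Set (ℝ × E³) :=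
    fun i => (Ioo (-1 : ℝ) 0 ×ˢ ball (y i) 1) ∩ uncurry w ⁻¹' {v : E³ | η < ‖v‖} with hB
  have hBm : ∀ i, MeasurableSet (B i) := fun i =>
    (rdCount_isOpen_box η w (y i) hcont).measurableSet
  -- (1) Tonelli for each lump
  have h1 : ∀ i, ENNReal.ofReal μ ≤ ∫⁻ t, volume (Prod.mk t ⁻¹' B i) := by
    intro i
    calc ENNReal.ofReal μ
        ≤ volume {z ∈ parabolicCylinder 1 ((0 : ℝ), y i) |
            η / Real.sqrt (-z.1) < ‖w z.1 z.2‖} := hlump i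
      _ ≤ volume (B i) := measure_mono (rdCount_lump_subset_box hη w (y i))
      _ = ∫⁻ t, volume (Prod.mk t ⁻¹' B i) := by
        rw [Measure.volume_eq_prod, Measure.prod_apply (hBm i)]
  -- (2) pointwise bound on the sum of the slices
  have h2 : ∀ t, ∑ i, volume (Prod.mk t ⁻¹' B i) ≤
      (Ioo (-1 : ℝ) 0).indicator (fun s => volume {x : E³ | η < ‖w s x‖}) t := by
    intro t
    by_cases ht : t ∈ Ioo (-1 : ℝ) 0
    · rw [indicator_of_mem ht]
      have hdisj : PairwiseDisjoint (↑(Finset.univ : Finset (Fin n)))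
          (fun i => Prod.mk t ⁻¹' B i) := by
        intro i _ j _ hij
        refine Disjoint.mono (fun x hx => hx.1.2) (fun x hx => hx.1.2)
          (ball_disjoint_ball (x := y i) (y := y j) (δ := 1) (ε := 1) ?_)
        rw [dist_eq_norm]
        linarith [hsep i j hij]
      rw [← measure_biUnion_finset hdisj fun i _ => measurable_prodMk_left (hBm i)]
      refine measure_mono fun x hx => ?_
      obtain ⟨i, -, hi⟩ := mem_iUnion₂.1 hx
      exact (rdCount_slice_subset η w (y i) t hi).2.2
    · rw [indicator_of_notMem ht]
      have h0 : ∀ i, Prod.mk t ⁻¹' B i = ∅ := fun i =>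
        eq_empty_of_forall_notMem fun x hx => ht (rdCount_slice_subset η w (y i) t hx).1
      simp [h0]
  -- (3) integrate in time
  have h3 : (n : ℝ≥0∞) * ENNReal.ofReal μ ≤
      ∫⁻ t in Ioo (-1 : ℝ) 0, volume {x : E³ | η < ‖w t x‖} := by
    calc (n : ℝ≥0∞) * ENNReal.ofReal μ = ∑ _i : Fin n, ENNReal.ofReal μ := by
          rw [Finset.sum_const, Finset.card_univ, Fintype.card_fin, nsmul_eq_mul]
      _ ≤ ∑ i : Fin n, ∫⁻ t, volume (Prod.mk t ⁻¹' B i) := Finset.sum_le_sum fun i _ => h1 i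
      _ = ∫⁻ t, ∑ i : Fin n, volume (Prod.mk t ⁻¹' B i) :=
          (lintegral_finsetSum _ fun i _ => measurable_measure_prodMk_left (hBm i)).symm
      _ ≤ ∫⁻ t, (Ioo (-1 : ℝ) 0).indicator (fun s => volume {x : E³ | η < ‖w s x‖}) t :=
          lintegral_mono h2
      _ = ∫⁻ t in Ioo (-1 : ℝ) 0, volume {x : E³ | η < ‖w t x‖} :=
          lintegral_indicator measurableSet_Ioo _
  -- (4) the weak-`L³` slice bound at `h = η`, a.e. on `(−1, 0)`
  have h4 : ∫⁻ t in Ioo (-1 : ℝ) 0, ENNReal.ofReal (η ^ 3) * volume {x : E³ | η < ‖w t x‖} ≤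
      ∫⁻ _t in Ioo (-1 : ℝ) 0, ENNReal.ofReal M := by
    refine lintegral_mono_ae ?_
    filter_upwards [ae_restrict_of_ae (s := Ioo (-1 : ℝ) 0) hM,
      ae_restrict_mem (measurableSet_Ioo (a := (-1 : ℝ)) (b := 0))] with t ht hts
    exact ht hts.2 η hη
  -- (5) combine
  have h5 : ENNReal.ofReal (η ^ 3) * ((n : ℝ≥0∞) * ENNReal.ofReal μ) ≤ ENNReal.ofReal M := by
    calc ENNReal.ofReal (η ^ 3) * ((n : ℝ≥0∞) * ENNReal.ofReal μ)
        ≤ ENNReal.ofReal (η ^ 3) * ∫⁻ t in Ioo (-1 : ℝ) 0, volume {x : E³ | η < ‖w t x‖} :=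
          by gcongr
      _ = ∫⁻ t in Ioo (-1 : ℝ) 0, ENNReal.ofReal (η ^ 3) * volume {x : E³ | η < ‖w t x‖} :=
          (lintegral_const_mul' _ _ ENNReal.ofReal_ne_top).symm
      _ ≤ ∫⁻ _t in Ioo (-1 : ℝ) 0, ENNReal.ofReal M := h4
      _ = ENNReal.ofReal M := by
          rw [setLIntegral_const, Real.volume_Ioo]
          simp
  calc ENNReal.ofReal ((n : ℝ) * μ * η ^ 3)
      = ENNReal.ofReal (η ^ 3) * ((n : ℝ≥0∞) * ENNReal.ofReal μ) := by
        rw [ENNReal.ofReal_mul (by positivity), ENNReal.ofReal_mul (by positivity),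
          ENNReal.ofReal_natCast, mul_comm]
    _ ≤ ENNReal.ofReal M := h5

end Summit.NavierStokesRegularity.NavierStokesRegularity.Theorems.RellichScarApexLocalisation

end
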